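import Literature.NumberTheory.QuadraticForms.HilbertReciprocityRat
import Mathlib.Data.ZMod.ValMinAbs
import Mathlib.Data.Nat.Factorization.Induction
import Mathlib.Data.Nat.Squarefree
import HarnessLib

/-!
# Lemmas for Legendre's theorem: norm groups, square roots modulo square-free integers,
# and the local step at an odd prime

Topic `NumberTheory/QuadraticForms`; namespace `Literature.NumberTheory.QuadraticForms`. Everything
here is proved. These are the ingredients of Serre's proof of the Hasse–Minkowski theorem for
ternary forms over `ℚ` (*A Course in Arithmetic*, Ch. IV §3.2 Thm. 8, case `n = 3`, PDF p. 41 of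
the held copy), assembled in `HasseMinkowskiTernaryRat.lean`:

* over any field `F` with `2 ≠ 0`: `(a, b)_F = 1` iff `b` is a norm `x² - a y²` from `F(√a)`
  (`hilbertSymbol_eq_one_iff_exists_norm`, O'Meara 63:10); the **norm-group trick**
  `b b' = t² - a ⇒ ((a, b)_F = 1 ↔ (a, b')_F = 1)` (`hilbertSymbol_eq_one_iff_of_mul_eq_sq_sub`,
  Brahmagupta's identity); a non-trivial zero of `Z² - aX² - bY²` gives `(a, b)_F = 1` and
  conversely (`hilbertSymbol_eq_one_of_ternary_zero`, `exists_ternary_zero_of_hilbertSymbol_eq_one`);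
* elementary arithmetic: a square mod every prime factor of a square-free `n` is a square mod `n`
  (CRT), with a square root `|t| ≤ n/2`; square-free representatives of integral and rational
  square classes;
* **Serre's local step**: if `b` is square-free, `p ∣ b`, and `(a, b)_v = 1` at all finite
  `v ∤ 2`, then `a` is a square mod `p` (`isSquare_zmod_of_hilbertSymbol_odd_places`; for odd
  `p ∤ a` this is `(a, p w)_p = (a / p)`, Serre III Thm. 1, through the tree's
  `hilbertSymbol_uniformizer_mul_iff`).

## References

* J.-P. Serre, *A Course in Arithmetic*, GTM 7, Springer 1973, Ch. III §1.1, §1.2 Thm. 1;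
  Ch. IV §3.2 Thm. 8 (ii) (PDF p. 41). [Serre1973]
* O. T. O'Meara, *Introduction to quadratic forms* (1963), §63B (63:10).
-/

noncomputable section

open IsDedekindDomain NumberField Rat.HeightOneSpectrum

namespace Literature.NumberTheory.QuadraticForms

/-! ### Norm groups: `(a, b)_F` only depends on `b` modulo norms from `F(√a)` -/

section Field

variable {F : Type*} [Field F]

/-- For `a ≠ 0`, `2 ≠ 0`: `(a, b)_F = 1` iff `b = x² - a y²` for some `x y` with `b ≠ 0` — the
norm form of `F(√a)` represents `b` (O'Meara §63B, 63:10). Witnesses: `a x² + b y² = 1` with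
`y ≠ 0` gives `b = (1/y)² - a (x/y)²`; with `y = 0`, `a = (1/x)²` and
`b = ((1+b)/2)² - a (x(1-b)/2)²`. Conversely `b = X² - aY²` with `X ≠ 0` gives
`a (Y/X)² + b (1/X)² = 1`, and with `X = 0`, `a ((1 + a⁻¹)/2)² + b ((1 - a⁻¹)/(2Y))² = 1`.
[cite: Omeara1963, §63B (63:10)] -/
theorem hilbertSymbol_eq_one_iff_exists_norm [NeZero (2 : F)] {a b : F} (ha : a ≠ 0)
    (hb : b ≠ 0) : hilbertSymbol F a b = 1 ↔ ∃ x y : F, x ^ 2 - a * y ^ 2 = b := by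
  have h2 : (2 : F) ≠ 0 := two_ne_zero
  rw [hilbertSymbol_eq_one_iff]
  constructor
  · rintro ⟨x, y, h⟩
    by_cases hy : y = 0
    · subst hy
      have hx : x ≠ 0 := by
        rintro rfl
        simp at h
      refine ⟨(1 + b) / 2, x * (1 - b) / 2, ?_⟩
      field_simp
      linear_combination -(b - 1) ^ 2 * h
    · refine ⟨1 / y, x / y, ?_⟩
      field_simp
      linear_combination -h
  · rintro ⟨X, Y, h⟩
    by_cases hX : X = 0
    · subst hX
      have hY : Y ≠ 0 := by
        rintro rfl
        apply hb
        linear_combination -h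
      refine ⟨(1 + a⁻¹) / 2, (1 - a⁻¹) / 2 / Y, ?_⟩
      field_simp
      linear_combination -(a - 1) ^ 2 * h
    · refine ⟨Y / X, 1 / X, ?_⟩
      field_simp
      linear_combination -h

/-- **The norm-group trick** of Serre's proof of Legendre's theorem (Ch. IV §3.2, case `n = 3`;
"the argument is the same as that for prop. 1 of chap. III"): if `b b' = t² - a` is a norm from
`F(√a)` (`a, b, b' ≠ 0`, `2 ≠ 0`), then `(a, b)_F = 1 ↔ (a, b')_F = 1`, because the non-zero
norms `x² - a y²` form a group (Brahmagupta's identity). [cite: Serre1973, Ch. IV §3.2 Thm. 8 (ii)] -/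
theorem hilbertSymbol_eq_one_iff_of_mul_eq_sq_sub [NeZero (2 : F)] {a b b' t : F} (ha : a ≠ 0)
    (hb : b ≠ 0) (hb' : b' ≠ 0) (h : b * b' = t ^ 2 - a) :
    hilbertSymbol F a b = 1 ↔ hilbertSymbol F a b' = 1 := by
  -- symmetric statement: one implication suffices
  suffices key : ∀ {c c' : F}, c ≠ 0 → c' ≠ 0 → c * c' = t ^ 2 - a →
      hilbertSymbol F a c = 1 → hilbertSymbol F a c' = 1 from
    ⟨key hb hb' h, key hb' hb (by rw [mul_comm]; exact h)⟩
  intro c c' hc hc' hcc' h1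
  obtain ⟨x, y, hxy⟩ := (hilbertSymbol_eq_one_iff_exists_norm ha hc).1 h1
  refine (hilbertSymbol_eq_one_iff_exists_norm ha hc').2 ⟨(t * x + a * y) / c, (t * y + x) / c, ?_⟩
  -- `c' = (t² - a)(x² - a y²) / c²` and Brahmagupta
  have hc'eq : c' = (t ^ 2 - a) * (x ^ 2 - a * y ^ 2) / c ^ 2 := by
    rw [hxy, ← hcc']; field_simp
  rw [hc'eq]
  field_simp
  ring

/-- **Isotropy of `Z² - aX² - bY²` and the Hilbert symbol** (`a b ≠ 0`, `2 ≠ 0`): a non-trivial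
zero of `Z² - aX² - bY²` forces `(a, b)_F = 1` (Serre, Ch. III §1.1: "`(a, b) = 1` if
`z² - ax² - by² = 0` has a non-trivial solution"; if `z ≠ 0` divide by `z`, if `z = 0` then
`b ∈ -a F²` and `(a, -a) = 1`). [cite: Serre1973, Ch. III §1.1] -/
theorem hilbertSymbol_eq_one_of_ternary_zero [NeZero (2 : F)] {a b x y z : F} (ha : a ≠ 0)
    (hb : b ≠ 0) (h : z ^ 2 - a * x ^ 2 - b * y ^ 2 = 0) (hne : x ≠ 0 ∨ y ≠ 0 ∨ z ≠ 0) :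
    hilbertSymbol F a b = 1 := by
  by_cases hz : z = 0
  · subst hz
    have hy : y ≠ 0 := by
      rintro rfl
      rcases hne with hx | hy | hz
      · apply hx
        have : a * x ^ 2 = 0 := by linear_combination -h
        simpa [ha] using this
      · exact hy rfl
      · exact hz rfl
    have hx : x ≠ 0 := by
      rintro rfl
      apply hb
      have : b * y ^ 2 = 0 := by linear_combination -h
      simpa [hy] using this
    have hbeq : b = -a * (x / y) ^ 2 := by
      field_simp
      linear_combination -h
    rw [hbeq, hilbertSymbol_mul_sq_right _ _ (div_ne_zero hx hy)]
    exact hilbertSymbol_neg_self_right ha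
  · refine (hilbertSymbol_eq_one_iff a b).2 ⟨x / z, y / z, ?_⟩
    field_simp
    linear_combination -h

/-- Conversely `(a, b)_F = 1` gives the zero `(x, y, 1)` of `Z² - aX² - bY²`. [cite: Serre1973, Ch. III §1.1] -/
theorem exists_ternary_zero_of_hilbertSymbol_eq_one {a b : F} (h : hilbertSymbol F a b = 1) :
    ∃ x y z : F, z ≠ 0 ∧ z ^ 2 - a * x ^ 2 - b * y ^ 2 = 0 := by
  obtain ⟨x, y, hxy⟩ := (hilbertSymbol_eq_one_iff a b).1 h
  exact ⟨x, y, 1, one_ne_zero, by linear_combination -hxy⟩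

end Field

/-! ### Square roots modulo a square-free integer -/

/-- If an integer `a` is a square modulo every prime divisor of the square-free natural number
`n`, then it is a square modulo `n` (Chinese remainder theorem; Serre: "since
`ℤ/bℤ = Π ℤ/pᵢℤ`, we see that `a` is a square modulo `b`"). [cite: Serre1973, Ch. IV §3.2 Thm. 8 (ii)] -/
theorem isSquare_zmod_of_forall_prime {n : ℕ} (hn : Squarefree n) {a : ℤ}
    (h : ∀ p : ℕ, p.Prime → p ∣ n → IsSquare (a : ZMod p)) : IsSquare (a : ZMod n) := by
  induction n using Nat.recOnPosPrimePosCoprime with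
  | zero => exact absurd hn not_squarefree_zero
  | one => exact ⟨(a : ZMod 1), Subsingleton.elim _ _⟩
  | prime_pow p k hp hk =>
    -- `k = 1` by square-freeness
    have hk1 : k = 1 := by
      by_contra hk1
      have hk2 : 2 ≤ k := by omega
      have hdvd : p * p ∣ p ^ k := by
        rw [← sq]; exact pow_dvd_pow p hk2
      exact hp.ne_one (by simpa using hn p hdvd)
    subst hk1
    rw [pow_one] at h ⊢
    exact h p hp dvd_rfl
  | coprime m k hm hk hmk ihm ihk =>
    have hm' := ihm (Squarefree.of_mul_left hn) fun p hp hpm ↦ h p hp (hpm.mul_right k)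
    have hk' := ihk (Squarefree.of_mul_right hn) fun p hp hpk ↦ h p hp (hpk.mul_left m)
    obtain ⟨r, hr⟩ := hm'
    obtain ⟨s, hs⟩ := hk'
    let e := ZMod.chineseRemainder hmk
    refine ⟨e.symm (r, s), e.injective ?_⟩
    rw [map_mul, RingEquiv.apply_symm_apply, Prod.mk_mul_mk, ← hr, ← hs, map_intCast]
    rfl

/-- A square root modulo `n` can be taken in `(-n/2, n/2]`: if `a` is a square mod `n ≠ 0` then
`n ∣ t² - a` for some integer `t` with `|t| ≤ n / 2` (Serre: "we can choose `t` in such a way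
that `|t| ≤ |b|/2`"). [cite: Serre1973, Ch. IV §3.2 Thm. 8 (ii)] -/
theorem exists_sq_sub_dvd_of_isSquare_zmod {n : ℕ} [NeZero n] {a : ℤ} (h : IsSquare (a : ZMod n)) :
    ∃ t : ℤ, t.natAbs ≤ n / 2 ∧ (n : ℤ) ∣ t ^ 2 - a := by
  obtain ⟨r, hr⟩ := h
  refine ⟨r.valMinAbs, ZMod.natAbs_valMinAbs_le r, ?_⟩
  rw [← ZMod.intCast_zmod_eq_zero_iff_dvd, Int.cast_sub, Int.cast_pow, ZMod.coe_valMinAbs, hr]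
  ring

/-! ### Square-free integral representatives of rational square classes -/

/-- Every non-zero integer is a square-free integer times a non-zero square. [folklore] -/
theorem Int.exists_squarefree_mul_sq {n : ℤ} (hn : n ≠ 0) :
    ∃ m u : ℤ, Squarefree m ∧ u ≠ 0 ∧ n = m * u ^ 2 := by
  obtain ⟨b, c, -, hc, hbc, hb⟩ := Nat.sq_mul_squarefree_of_pos (Int.natAbs_pos.2 hn)
  -- `natAbs n = c² b`: `n = sign n · b · c²`
  have hsign : (n.sign : ℤ).natAbs = 1 := by
    rcases lt_or_gt_of_ne hn with h | h
    · rw [Int.sign_eq_neg_one_of_neg h]; rfl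
    · rw [Int.sign_eq_one_of_pos h]; rfl
  refine ⟨n.sign * b, c, ?_, by exact_mod_cast hc.ne', ?_⟩
  · rw [← Int.squarefree_natAbs, Int.natAbs_mul, hsign, one_mul, Int.natAbs_natCast]
    exact hb
  · have h1 : (n.natAbs : ℤ) = (c : ℤ) ^ 2 * b := by exact_mod_cast hbc.symm
    calc n = n.sign * (n.natAbs : ℤ) := (Int.sign_mul_natAbs n).symm
      _ = n.sign * b * (c : ℤ) ^ 2 := by rw [h1]; ring

/-- Every non-zero rational is a square-free integer times a non-zero rational square
(`a c² = A` with `A` square-free). [folklore] -/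
theorem Rat.exists_mul_sq_eq_squarefree {a : ℚ} (ha : a ≠ 0) :
    ∃ (A : ℤ) (c : ℚ), A ≠ 0 ∧ c ≠ 0 ∧ Squarefree A ∧ a * c ^ 2 = (A : ℚ) := by
  obtain ⟨A', c', hA', hc', hAc'⟩ := Rat.exists_mul_sq_eq_intCast ha
  obtain ⟨m, u, hm, hu, hmu⟩ := Int.exists_squarefree_mul_sq hA'
  have hm0 : m ≠ 0 := by rintro rfl; simp at hmu; exact hA' hmu
  refine ⟨m, c' / u, hm0, div_ne_zero hc' (by exact_mod_cast hu), hm, ?_⟩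
  have hu' : (u : ℚ) ≠ 0 := by exact_mod_cast hu
  field_simp
  rw [hAc', hmu]; push_cast; ring

/-! ### The local input at an odd prime: `(a, b)_p = 1`, `p ∥ b`, `p ∤ a` forces `a ≡ □ (mod p)` -/

section Rat

open RatPlace

/-- `2 ∉ v` for a finite place `v` of `ℚ` not over `2`. [folklore] -/
theorem two_not_mem_of_natGenerator_ne_two (v : HeightOneSpectrum (𝓞 ℚ)) (hv2 : natGenerator v ≠ 2) :
    (2 : 𝓞 ℚ) ∉ v.asIdeal := by
  have h := intCast_mem_asIdeal_iff v 2
  rw [Int.cast_ofNat] at h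
  rw [h]
  intro hd
  exact hv2 ((Nat.prime_dvd_prime_iff_eq (prime_natGenerator v) Nat.prime_two).1
    (by exact_mod_cast hd))

/-- **Serre's local step** (Ch. IV §3.2 Thm. 8 (ii)): let `b` be a square-free integer, `p` a prime
dividing `b`, and suppose `(a, b)_v = 1` at every finite place `v ∤ 2` of `ℚ`. Then `a` is a
square modulo `p`. For `p ∣ a` this is trivial, for `p = 2` every residue is a square, and for
`p ∤ 2a` it is the rule `(a, p w)_p = (a / p)` (Serre III Thm. 1; in the tree
`hilbertSymbol_uniformizer_mul_iff`). (Serre argues directly with a primitive `p`-adic zero of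
`Z² - aX² - bY²`.) [cite: Serre1973, Ch. IV §3.2 Thm. 8 (ii)] -/
theorem isSquare_zmod_of_hilbertSymbol_odd_places {a b : ℤ} (hb : Squarefree b) {p : ℕ}
    (hp : p.Prime) (hpb : (p : ℤ) ∣ b)
    (hloc : ∀ v : HeightOneSpectrum (𝓞 ℚ), natGenerator v ≠ 2 →
      hilbertSymbol (v.adicCompletion ℚ) (algebraMap ℚ _ (a : ℚ)) (algebraMap ℚ _ (b : ℚ)) = 1) :
    IsSquare (a : ZMod p) := by
  by_cases hpa : (p : ℤ) ∣ a
  · rw [(ZMod.intCast_zmod_eq_zero_iff_dvd a p).2 hpa]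
    exact ⟨0, (mul_zero 0).symm⟩
  by_cases hp2 : p = 2
  · subst hp2
    have h2 : ∀ x : ZMod 2, IsSquare x := by decide
    exact h2 _
  -- `p` odd, `p ∤ a`: use the place over `p`
  obtain ⟨v, rfl⟩ : ∃ v : HeightOneSpectrum (𝓞 ℚ), natGenerator v = p :=
    ⟨(primesEquiv (R := 𝓞 ℚ)).symm ⟨p, hp⟩,
      congrArg Subtype.val ((primesEquiv (R := 𝓞 ℚ)).apply_symm_apply ⟨p, hp⟩)⟩
  set p := natGenerator v with hpdef
  have hv2 : natGenerator v ≠ 2 := hp2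
  have h2v := two_not_mem_of_natGenerator_ne_two v hv2
  obtain ⟨w, rfl⟩ := hpb
  have hpw : ¬ (p : ℤ) ∣ w := by
    intro hw
    have : (p : ℤ) * p ∣ p * w := mul_dvd_mul_left _ hw
    exact hp.ne_one (by
      have h1 := hb (p : ℤ) this
      rw [Int.isUnit_iff] at h1
      rcases h1 with h1 | h1
      · exact_mod_cast h1
      · have : (0 : ℤ) ≤ (p : ℤ) := Int.natCast_nonneg p
        omega)
  have hav : (a : 𝓞 ℚ) ∉ v.asIdeal := by rw [intCast_mem_asIdeal_iff]; exact hpa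
  have hwv : (w : 𝓞 ℚ) ∉ v.asIdeal := by rw [intCast_mem_asIdeal_iff]; exact hpw
  have hπ : v.intValuation ((natGenerator v : ℕ) : 𝓞 ℚ) = WithZero.exp (-1 : ℤ) :=
    intValuation_natGenerator v
  have h1 := hloc v hv2
  rw [hilbertSymbol_comm, algebraMap_rat_intCast, algebraMap_rat_intCast,
    show (((natGenerator v : ℕ) * w : ℤ) : 𝓞 ℚ) = ((natGenerator v : ℕ) : 𝓞 ℚ) * (w : 𝓞 ℚ) by
      push_cast; ring] at h1
  have hsq := (hilbertSymbol_uniformizer_mul_iff ℚ v h2v hπ hwv hav).1 h1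
  rwa [isSquare_mk_intCast_iff] at hsq

end Rat

end Literature.NumberTheory.QuadraticForms
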